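import Summits.ValiantsHypothesis.ValiantsHypothesis.Theses.SymPencil
import Summits.ValiantsHypothesis.ValiantsHypothesis.Theorems.SymPencilSdcPerFourNineteen
import Summits.ValiantsHypothesis.ValiantsHypothesis.Theorems.SymPencilSdcSuperquadraticStubBoxFourEq
import Summits.ValiantsHypothesis.ValiantsHypothesis.Theorems.SymPencilSdcSuperquadraticStubDefectForm
import Summits.ValiantsHypothesis.ValiantsHypothesis.Theorems.SymPencilSdcSuperquadraticStubBlockRankFour

/-!
# Crux `SdcSuperquadratic` (stmt-ValiantsHypothesis-5674) — skeleton of line `box-four`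
# (a FINITE RUNG line: target `sdc(per_4) ≥ 21`, NOT the asymptotic crux)

HONEST CALIBRATION.  The crux `SdcSuperquadratic` (`sdc(per_n) ≥ n^{2+ε}` for all large `n`) IS the
open "first bound past the number-of-variables wall" problem of the field in the symmetric model
(dc record `n²/2`, Mignon–Ressayre 2004; Landsberg 2017 Rem. 6.4.6.5; tree: `sdc(per_n) ≥ n² + 1`
for all `n ≥ 3`, p551800); no decomposition of it into strictly smaller stubs is known — every
engine in the tree (Hessian rank, cone kernel, kernel-row injectivity p562055) saturates at
`2n² − 3`, still quadratic (`Cruxes/SdcPerBeyondN/NEXT-RUNG.md` (A)(B)).  It is moreover an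
UNUSED binder of the route's `closes` (SymPencil rev 3 readback: the deciding chain runs through
`SymmetrizePermPairs`/`EquivariantSdcNotQP`).  So this line does NOT conclude the crux: it is the
registered form of the lane's next RUNG, `sdc(per_4) ≥ 21` (tree: `19`, p565272; window
`19 ≤ sdc(per₄) ≤ 306`, p566509), registered on the item with `--crux-decl` = the rung
`SdcPerFourTwentyOne` below.  Rung currency only; VP ≠ VNP is not moved.

MECHANISM (NEXT-RUNG.md (D), prover val-width-5676-p2 g2/g3).  In the origin normal form of a symmetric
affine determinantal representation of `per_4` of size `m` (`Pᵀ A₀ P = 0 ⊕ D`, `Pᵀ M(z) P =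
[[0, bᵀ],[b, C]]`) the kernel `V = ker b` lies in `Sing Z(per_4)` (all `3 × 3` subpermanents vanish
on `V`, so `dim V ≤ 8`, Alper–Bogart–Velasco BoxFour) and `B = im b` is `D⁻¹`-isotropic in
`K^{m-1}`; `dim V + dim B = 16`.  For `m ≤ 20` the only non-contradictory case is `dim V = 8`
with DEFECT `δ = m − 17 ≤ 3`, and then the `s²`-coefficient of `per_4(u + s y)` (`y ∈ V`) is a
quadratic form of rank `≤ δ ≤ 3` in `y` (`stub_defectForm`; `δ ≤ 1` is the landed
`SymPencilIsotropicKernelDefect`/`SymPencilPerFourBlocksSq`).  The EQUALITY CASE of BoxFour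
(`stub_boxFourEq`, being landed by 5676-p2 g3: `SymPencilBoxFourProfile/Filtration/Graph/Toric`,
p570368, p570880, …) says an `8`-dimensional `V` has two zero rows or two zero columns; but on such
a `V` the `s²`-coefficient at `u = E_{p0} + E_{q1}` is the rank-`4` form `y_{a2}y_{b3} + y_{a3}y_{b2}`
(`stub_blockRankFour`).  Contradiction, so `m ≥ 21`.

Composition `SdcPerFourTwentyOne_of_line` (= `twentyOne_le_of stub_boxFourEq stub_defectForm
stub_blockRankFour`) is kernel-checked below.

STATUS 2026-08-27 (val-width-5674-p2 g0): ALL THREE STUBS LANDED — the file is sorry-free and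
`SdcPerFourTwentyOne_of_line : SdcPerFourTwentyOne` is a theorem.  `stub_boxFourEq` :=
`Theorems.SymPencilSdcSuperquadraticStubBoxFourEq.stub_boxFourEq` (the `ℂ`-instance of
val-width-5676-p2 g3's `SymPencilBoxFourEquality.two_rows_or_two_cols`, p572599);
`stub_defectForm` := `Theorems.SymPencilSdcSuperquadraticStubDefectForm.stub_defectForm`
(val-width-5674-p2, via the defect-`d` squares lemma `SymPencilIsotropicKernelSquares` and
`SymPencilRadicalSumSquares`); `stub_blockRankFour` :=
`Theorems.SymPencilSdcSuperquadraticStubBlockRankFour.stub_blockRankFour` (val-width-5674-p1,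
p576071).  The rung in Theorems form (any field of characteristic `0`, plus the window
`21 ≤ sdc(per₄) ≤ 306`): `Theorems.SymPencilSdcPerFourTwentyOne`.  The crux `SdcSuperquadratic`
itself is unchanged (open); next wall: `m = 21`, case `dim V = 7` with defect `2`.
-/

noncomputable section

set_option linter.dupNamespace false

namespace Summit.ValiantsHypothesis.ValiantsHypothesis.Cruxes.SdcSuperquadratic.BoxFour

open MvPolynomial Module Literature.Computability.AlgebraicComplexity

/-- **RUNG TARGET of the line** (registered with `--crux-decl`): every symmetric affine
determinantal representation of `per_4` over `ℂ` has size `≥ 21`.  (Tree: `≥ 19`,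
`SymPencilSdcPerFourNineteen.nineteen_le_of_isSymm_isAffineDetRepr_perPoly_four`.)  This is a
finite data point of the theme of `SdcSuperquadratic`, not a consequence or an antecedent of it.
[folklore] -/
def SdcPerFourTwentyOne : Prop :=
  ∀ (m : ℕ) (A : Matrix (Fin m) (Fin m) (MvPolynomial (Fin 4 × Fin 4) ℂ)), A.IsSymm →
    IsAffineDetRepr (perPoly (Fin 4) ℂ) A → 21 ≤ m

/-- STUB 1 (BoxFour equality case — classification; val-width-5676-p2 g3 is landing it as
`eq_rows_or_cols_of_finrank_eq_eight` over any field of characteristic `0`): an `8`-dimensional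
space of `4 × 4` matrices on which all sixteen `3 × 3` subpermanents vanish has two zero rows or
two zero columns.  Why it might fail: a `(2,2,2,2)`-profile space built from three 2-planes
satisfying the trilinear constraints (g3: excluded by the toric/graph dichotomy). [folklore] -/
theorem stub_boxFourEq :
    ∀ W : Submodule ℂ (Fin 4 × Fin 4 → ℂ),
      (∀ x ∈ W, ∀ (r c : Fin 3 → Fin 4), Function.Injective r → Function.Injective c →
        ((Matrix.of fun i j => x (i, j)).submatrix r c).permanent = 0) →
      finrank ℂ W = 8 →
      (∃ p q : Fin 4, p ≠ q ∧ ∀ x ∈ W, ∀ j, x (p, j) = 0 ∧ x (q, j) = 0) ∨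
      (∃ p q : Fin 4, p ≠ q ∧ ∀ x ∈ W, ∀ i, x (i, p) = 0 ∧ x (i, q) = 0) :=
  Summit.ValiantsHypothesis.ValiantsHypothesis.Theorems.SymPencilSdcSuperquadraticStubBoxFourEq.stub_boxFourEq

/-- STUB 2 (defect form of the `s²`-coefficient, sizes `m ≤ 20`): a symmetric affine
determinantal representation of `per_4` of size `m ≤ 20` yields an `8`-dimensional subspace `V`
inside `Sing Z(per_4)` along which, for every base point `u`, `per_4(u + s y)` is
`e₀ + e₁ s + s²·(quadratic form of rank ≤ 3 in y)`.  (Origin moments + isotropy: `dim V = 8`,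
`B = im b` isotropic of defect `δ = m − 17 ≤ 3`, the `s²`-coefficient factors through
`B^⊥/D⁻¹B`, `dim ≤ δ`; the cases `dim V = 7` are self-contradictory by the landed affine /
square lemmas.  `δ ≤ 1`: `SymPencilIsotropicKernelDefect.sq_of_isotropic_defect_le_one`.)
Why it might fail: only by a slip in the defect bookkeeping — the factorisation through the
`δ`-dimensional quotient is forced by moment (ii). [folklore] -/
theorem stub_defectForm :
    ∀ m : ℕ, m ≤ 20 → ∀ A : Matrix (Fin m) (Fin m) (MvPolynomial (Fin 4 × Fin 4) ℂ), A.IsSymm →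
      IsAffineDetRepr (perPoly (Fin 4) ℂ) A →
      ∃ V : Submodule ℂ (Fin 4 × Fin 4 → ℂ),
        (∀ x ∈ V, ∀ (r c : Fin 3 → Fin 4), Function.Injective r → Function.Injective c →
          ((Matrix.of fun i j => x (i, j)).submatrix r c).permanent = 0) ∧
        finrank ℂ V = 8 ∧
        ∀ u : Fin 4 × Fin 4 → ℂ, ∃ (c : Fin 3 → ℂ) (Λ : Fin 3 → ((Fin 4 × Fin 4 → ℂ) →ₗ[ℂ] ℂ)),
          ∀ y ∈ V, ∃ e₀ e₁ : ℂ, ∀ s : ℂ,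
            eval (u + s • y) (perPoly (Fin 4) ℂ) = e₀ + s * e₁ + s ^ 2 * ∑ k, c k * (Λ k y) ^ 2 :=
  Summit.ValiantsHypothesis.ValiantsHypothesis.Theorems.SymPencilSdcSuperquadraticStubDefectForm.stub_defectForm

/-- STUB 3 (the two-free-rows block has rank `4`): on an `8`-dimensional space with two zero rows
(or columns) — necessarily ALL matrices supported on the other two rows `a, b` — the
`s²`-coefficient of `per_4(u + s y)` at `u = E_{p0} + E_{q1}` is `y_{a2} y_{b3} + y_{a3} y_{b2}`, a
quadratic form of rank `4`, so it is not of rank `≤ 3` for every `u`.  Why it might fail: it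
cannot once the space is the full coordinate block; the content is the rank comparison.
[folklore] -/
theorem stub_blockRankFour :
    ∀ V : Submodule ℂ (Fin 4 × Fin 4 → ℂ), finrank ℂ V = 8 →
      ((∃ p q : Fin 4, p ≠ q ∧ ∀ x ∈ V, ∀ j, x (p, j) = 0 ∧ x (q, j) = 0) ∨
        (∃ p q : Fin 4, p ≠ q ∧ ∀ x ∈ V, ∀ i, x (i, p) = 0 ∧ x (i, q) = 0)) →
      ¬ (∀ u : Fin 4 × Fin 4 → ℂ, ∃ (c : Fin 3 → ℂ) (Λ : Fin 3 → ((Fin 4 × Fin 4 → ℂ) →ₗ[ℂ] ℂ)),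
          ∀ y ∈ V, ∃ e₀ e₁ : ℂ, ∀ s : ℂ,
            eval (u + s • y) (perPoly (Fin 4) ℂ) =
              e₀ + s * e₁ + s ^ 2 * ∑ k, c k * (Λ k y) ^ 2) :=
  Summit.ValiantsHypothesis.ValiantsHypothesis.Theorems.SymPencilSdcSuperquadraticStubBlockRankFour.stub_blockRankFour

/-- **The case analysis behind the line**: the three stubs (as hypotheses) give `21 ≤ m` for every
symmetric affine determinantal representation of `per_4`. [folklore] -/
theorem twentyOne_le_of
    (h₁ : ∀ W : Submodule ℂ (Fin 4 × Fin 4 → ℂ),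
      (∀ x ∈ W, ∀ (r c : Fin 3 → Fin 4), Function.Injective r → Function.Injective c →
        ((Matrix.of fun i j => x (i, j)).submatrix r c).permanent = 0) →
      finrank ℂ W = 8 →
      (∃ p q : Fin 4, p ≠ q ∧ ∀ x ∈ W, ∀ j, x (p, j) = 0 ∧ x (q, j) = 0) ∨
      (∃ p q : Fin 4, p ≠ q ∧ ∀ x ∈ W, ∀ i, x (i, p) = 0 ∧ x (i, q) = 0))
    (h₂ : ∀ m : ℕ, m ≤ 20 → ∀ A : Matrix (Fin m) (Fin m) (MvPolynomial (Fin 4 × Fin 4) ℂ),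
      A.IsSymm → IsAffineDetRepr (perPoly (Fin 4) ℂ) A →
      ∃ V : Submodule ℂ (Fin 4 × Fin 4 → ℂ),
        (∀ x ∈ V, ∀ (r c : Fin 3 → Fin 4), Function.Injective r → Function.Injective c →
          ((Matrix.of fun i j => x (i, j)).submatrix r c).permanent = 0) ∧
        finrank ℂ V = 8 ∧
        ∀ u : Fin 4 × Fin 4 → ℂ, ∃ (c : Fin 3 → ℂ) (Λ : Fin 3 → ((Fin 4 × Fin 4 → ℂ) →ₗ[ℂ] ℂ)),
          ∀ y ∈ V, ∃ e₀ e₁ : ℂ, ∀ s : ℂ,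
            eval (u + s • y) (perPoly (Fin 4) ℂ) = e₀ + s * e₁ + s ^ 2 * ∑ k, c k * (Λ k y) ^ 2)
    (h₃ : ∀ V : Submodule ℂ (Fin 4 × Fin 4 → ℂ), finrank ℂ V = 8 →
      ((∃ p q : Fin 4, p ≠ q ∧ ∀ x ∈ V, ∀ j, x (p, j) = 0 ∧ x (q, j) = 0) ∨
        (∃ p q : Fin 4, p ≠ q ∧ ∀ x ∈ V, ∀ i, x (i, p) = 0 ∧ x (i, q) = 0)) →
      ¬ (∀ u : Fin 4 × Fin 4 → ℂ, ∃ (c : Fin 3 → ℂ) (Λ : Fin 3 → ((Fin 4 × Fin 4 → ℂ) →ₗ[ℂ] ℂ)),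
          ∀ y ∈ V, ∃ e₀ e₁ : ℂ, ∀ s : ℂ,
            eval (u + s • y) (perPoly (Fin 4) ℂ) =
              e₀ + s * e₁ + s ^ 2 * ∑ k, c k * (Λ k y) ^ 2))
    (m : ℕ) (A : Matrix (Fin m) (Fin m) (MvPolynomial (Fin 4 × Fin 4) ℂ)) (hS : A.IsSymm)
    (hA : IsAffineDetRepr (perPoly (Fin 4) ℂ) A) : 21 ≤ m := by
  by_contra hlt
  obtain ⟨V, hV3, hV8, hform⟩ := h₂ m (by omega) A hS hA
  exact h₃ V hV8 (h₁ V hV3 hV8) hform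

/-- **Composition of the line**: the RUNG target by name from the three stubs
(`stub_boxFourEq → stub_defectForm → stub_blockRankFour → SdcPerFourTwentyOne`). [folklore] -/
theorem SdcPerFourTwentyOne_of_line : SdcPerFourTwentyOne := fun m A hS hA =>
  twentyOne_le_of stub_boxFourEq stub_defectForm stub_blockRankFour m A hS hA

/-- Sanity link to the tree (not a stub): the rung target strengthens the landed `19 ≤ m`.
[folklore] -/
theorem nineteen_le_of_twentyOne (h : SdcPerFourTwentyOne) (m : ℕ)
    (A : Matrix (Fin m) (Fin m) (MvPolynomial (Fin 4 × Fin 4) ℂ)) (hS : A.IsSymm)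
    (hA : IsAffineDetRepr (perPoly (Fin 4) ℂ) A) : 19 ≤ m :=
  le_trans (by norm_num) (h m A hS hA)

end Summit.ValiantsHypothesis.ValiantsHypothesis.Cruxes.SdcSuperquadratic.BoxFour

end
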